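import Literature.Analysis.OperatorTheory.HeterogeneousCyclicPeeling
import Literature.Analysis.OperatorTheory.KernelCyclicPeeling
import HarnessLib

/-!
# Sector Cauchy–Schwarz for a symmetric kernel chain with an involutive symmetry (heavy-twist wall, reading B)

HELPER for the crux `BalabanLadder.IR` (stmt-QuantumFields-19354), line `heavy-twist` RUNG 2 on even boxes (wall seat
`ym-ir-wall-p1`; recipe ym-ir-crit-3 2026-08-28T07:11:56Z; mechanism = idea-2 O10 «sector Cauchy–Schwarz», here re-derived at
the KERNEL level so that no operator trace is needed).  Abstract, model-free, sorry-free.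

Setting: a finite measure space `(Y, ρ)`, a bounded measurable two-point function `F : Y → Y → ℝ` (in the application the
`h`-fold iterated transfer kernel `K_h` of an even cycle of `2h` time slices), a measurable measure-preserving INVOLUTION `T`
of `Y` ('t Hooft's centre flip of one slice; no invariance of `F` is needed for the inequality), and a bounded measurable
`T`-ODD one-slice observable `f` (`f ∘ T = −f`, `|f| ≤ B`; the slice Polyakov magnetisation).  With the four numbers

  `Z = ∫∫ F²`, `Zᵀ = ∫∫ F(Tx, y) F(x, y)`, `X = ∫∫ f(x) f(y) F²`, `W = ∫∫ f(x)² F²`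

(untwisted trace, twisted trace, two-slice correlation, one-slice second moment — all times the cycle's normalisation),
the **sector inequalities** `X² ≤ 2 B² W (Z − Zᵀ)` and `X² ≤ 2 B² W (Z + Zᵀ)` hold (`sector_cauchySchwarz`): both
`T`-sectors `(Z ± Zᵀ)/2 = ∫∫ F±²`, `F± = (F ± F∘(T×1))/2`, weigh at least `X²/(4B²W)`.  Proof: `f ⊗ f` exchanges the two
sectors (`∫∫ f f F±² = 0` by the substitution `x ↦ Tx`), so `X = 2∫∫ (f F₊)(f F₋)`; Cauchy–Schwarz; `∫∫ f² F₊ F₋ = 0`.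

HONEST FRAMING: an inequality between finite-box traces; nothing here is about Yang–Mills specifically, and nothing here
proves `BalabanLadder.IR`, its seed `E`, or the Yang–Mills mass gap (Clay); R4 closes only `BalabanLadder.UV`.
References: C. Borgs, E. Seiler, Commun. Math. Phys. 91 (1983) 329, Lemma II.6–II.8; G. 't Hooft, Nucl. Phys. B 153 (1979) 141 §§4–5.
-/

set_option autoImplicit false

noncomputable section

open MeasureTheory Filter Set Function

namespace Summit.QuantumFields.YangMills.Cruxes.IR.HeavyTwistWall

section CS

variable {Ω : Type*} [MeasurableSpace Ω] (π : Measure Ω) [IsFiniteMeasure π]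

/-- Bounded measurable real functions on a finite measure space are integrable. -/
theorem integrable_of_bdd {a : Ω → ℝ} (ha : Measurable a) {A : ℝ} (hab : ∀ ω, ‖a ω‖ ≤ A) : Integrable a π :=
  Integrable.of_bound ha.aestronglyMeasurable A (Eventually.of_forall hab)

/-- **Cauchy–Schwarz for real integrals** in discriminant form: `(∫ a b)² ≤ (∫ a²)(∫ b²)` for bounded measurable `a, b` on a
finite measure space (the quadratic `t ↦ ∫ (a + t b)² ≥ 0` has non-positive discriminant). -/
theorem sq_integral_mul_le {a b : Ω → ℝ} (ha : Measurable a) (hb : Measurable b) {A B : ℝ}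
    (hab : ∀ ω, ‖a ω‖ ≤ A) (hbb : ∀ ω, ‖b ω‖ ≤ B) :
    (∫ ω, a ω * b ω ∂π) ^ 2 ≤ (∫ ω, a ω ^ 2 ∂π) * ∫ ω, b ω ^ 2 ∂π := by
  have hA : 0 ≤ A ∨ IsEmpty Ω := by
    by_cases h : Nonempty Ω
    · exact Or.inl ((norm_nonneg _).trans (hab h.some))
    · exact Or.inr (not_nonempty_iff.mp h)
  -- integrability of the three products
  have hia2 : Integrable (fun ω => a ω ^ 2) π :=
    integrable_of_bdd π (ha.pow_const 2) (A := A ^ 2) fun ω => by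
      rw [norm_pow]; exact pow_le_pow_left₀ (norm_nonneg _) (hab ω) 2
  have hib2 : Integrable (fun ω => b ω ^ 2) π :=
    integrable_of_bdd π (hb.pow_const 2) (A := B ^ 2) fun ω => by
      rw [norm_pow]; exact pow_le_pow_left₀ (norm_nonneg _) (hbb ω) 2
  have hiab : Integrable (fun ω => a ω * b ω) π :=
    integrable_of_bdd π (ha.mul hb) (A := A * B) fun ω => by
      rw [norm_mul]; exact mul_le_mul (hab ω) (hbb ω) (norm_nonneg _) ((norm_nonneg _).trans (hab ω))
  -- the quadratic in `t`
  have hquad : ∀ t : ℝ, 0 ≤ (∫ ω, b ω ^ 2 ∂π) * (t * t) + (2 * ∫ ω, a ω * b ω ∂π) * t + ∫ ω, a ω ^ 2 ∂π := by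
    intro t
    have h0 : 0 ≤ ∫ ω, (a ω + t * b ω) ^ 2 ∂π := integral_nonneg fun ω => sq_nonneg _
    have hexp : ∫ ω, (a ω + t * b ω) ^ 2 ∂π =
        ∫ ω, (a ω ^ 2 + (2 * t) * (a ω * b ω) + (t * t) * b ω ^ 2) ∂π :=
      integral_congr_ae (Eventually.of_forall fun ω => by ring)
    have e1 : ∫ ω, (a ω ^ 2 + (2 * t) * (a ω * b ω) + (t * t) * b ω ^ 2) ∂π =
        (∫ ω, (a ω ^ 2 + (2 * t) * (a ω * b ω)) ∂π) + ∫ ω, (t * t) * b ω ^ 2 ∂π :=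
      integral_add (f := fun ω => a ω ^ 2 + (2 * t) * (a ω * b ω)) (g := fun ω => (t * t) * b ω ^ 2)
        (hia2.add (hiab.const_mul (2 * t))) (hib2.const_mul (t * t))
    have e2 : ∫ ω, (a ω ^ 2 + (2 * t) * (a ω * b ω)) ∂π = (∫ ω, a ω ^ 2 ∂π) + ∫ ω, (2 * t) * (a ω * b ω) ∂π :=
      integral_add (f := fun ω => a ω ^ 2) (g := fun ω => (2 * t) * (a ω * b ω)) hia2 (hiab.const_mul (2 * t))
    rw [hexp, e1, e2, integral_const_mul, integral_const_mul] at h0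
    linarith
  have hd := discrim_le_zero hquad
  rw [discrim] at hd
  nlinarith [hd]

omit [IsFiniteMeasure π] in
/-- Linearity for a three-term combination of integrable real functions. -/
theorem integral_lin3 {u v w : Ω → ℝ} (hu : Integrable u π) (hv : Integrable v π) (hw : Integrable w π) (α β γ : ℝ) :
    ∫ ω, (α * u ω + β * v ω + γ * w ω) ∂π = α * ∫ ω, u ω ∂π + β * ∫ ω, v ω ∂π + γ * ∫ ω, w ω ∂π := by
  have e1 : ∫ ω, (α * u ω + β * v ω + γ * w ω) ∂π = (∫ ω, (α * u ω + β * v ω) ∂π) + ∫ ω, γ * w ω ∂π :=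
    integral_add (f := fun ω => α * u ω + β * v ω) (g := fun ω => γ * w ω)
      ((hu.const_mul α).add (hv.const_mul β)) (hw.const_mul γ)
  have e2 : ∫ ω, (α * u ω + β * v ω) ∂π = (∫ ω, α * u ω ∂π) + ∫ ω, β * v ω ∂π :=
    integral_add (f := fun ω => α * u ω) (g := fun ω => β * v ω) (hu.const_mul α) (hv.const_mul β)
  rw [e1, e2, integral_const_mul, integral_const_mul, integral_const_mul]

end CS

/-! ## The involution on the first factor of `Y × Y`: substitution and vanishing of odd integrands -/

section Involution

variable {Y : Type*} [MeasurableSpace Y] {ρ : Measure Y} [IsFiniteMeasure ρ] {T : Y → Y}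

/-- **Substitution `x ↦ T x` in the first variable**: `∫ g(Tx, y) d(ρ⊗ρ) = ∫ g d(ρ⊗ρ)` for a measure-preserving measurable
involution `T`. -/
theorem integral_comp_fst_involution (hTm : Measurable T) (hT : MeasurePreserving T ρ ρ) (hTT : ∀ x, T (T x) = x)
    (g : Y × Y → ℝ) :
    ∫ p, g (T p.1, p.2) ∂(ρ.prod ρ) = ∫ p, g p ∂(ρ.prod ρ) := by
  have hmp : MeasurePreserving (Prod.map T id) (ρ.prod ρ) (ρ.prod ρ) := hT.prod (MeasurePreserving.id ρ)
  -- the involution as a measurable equivalence (inline; no definition is introduced)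
  let e : Y ≃ᵐ Y :=
    { toFun := T, invFun := T, left_inv := hTT, right_inv := hTT, measurable_toFun := hTm, measurable_invFun := hTm }
  have hemb : MeasurableEmbedding (Prod.map T (id : Y → Y)) := (e.prodCongr (MeasurableEquiv.refl Y)).measurableEmbedding
  exact hmp.integral_comp hemb g

/-- An integrand that is ODD under `x ↦ T x` integrates to zero. -/
theorem integral_eq_zero_of_odd_fst (hTm : Measurable T) (hT : MeasurePreserving T ρ ρ) (hTT : ∀ x, T (T x) = x)
    {g : Y × Y → ℝ} (hodd : ∀ x y, g (T x, y) = -g (x, y)) :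
    ∫ p, g p ∂(ρ.prod ρ) = 0 := by
  have h := integral_comp_fst_involution hTm hT hTT g
  have h2 : ∫ p, g (T p.1, p.2) ∂(ρ.prod ρ) = -∫ p, g p ∂(ρ.prod ρ) := by
    rw [← integral_neg]
    exact integral_congr_ae (Eventually.of_forall fun p => hodd p.1 p.2)
  linarith

end Involution

/-! ## The sector Cauchy–Schwarz inequality -/

section Sector

variable {Y : Type*} [MeasurableSpace Y] {ρ : Measure Y} [IsFiniteMeasure ρ] {T : Y → Y} {F : Y → Y → ℝ} {f : Y → ℝ}
  {B C : ℝ}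

/-- **Sector Cauchy–Schwarz (abstract, kernel level).**  `T` a measurable measure-preserving involution of a finite measure
space `(Y, ρ)`, `F` a bounded measurable two-point function (NO invariance of `F` under `T` is needed), `f` a bounded
measurable `T`-odd function, `|f| ≤ B`.  With `Z = ∫∫ F²`, `Zᵀ = ∫∫ F(Tx,y) F(x,y)`, `X = ∫∫ f(x) f(y) F(x,y)²`, `W = ∫∫ f(x)² F(x,y)²` (integrals
over `ρ ⊗ ρ`):  `X² ≤ 2 B² W (Z − Zᵀ)` and `X² ≤ 2 B² W (Z + Zᵀ)` — each `T`-sector `(Z ∓ Zᵀ)/2` carries at least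
`X²/(4 B² W)` of the trace. [mechanism: Borgs–Seiler 1983 Lemma II.6–II.8; idea-2 O10] -/
theorem sector_cauchySchwarz (hTm : Measurable T) (hT : MeasurePreserving T ρ ρ) (hTT : ∀ x, T (T x) = x)
    (hF : Measurable (uncurry F)) (hFb : ∀ x y, ‖F x y‖ ≤ C)
    (hf : Measurable f) (hfb : ∀ x, ‖f x‖ ≤ B) (hfT : ∀ x, f (T x) = -f x) :
    (∫ p, f p.1 * f p.2 * F p.1 p.2 ^ 2 ∂(ρ.prod ρ)) ^ 2 ≤
        2 * B ^ 2 * (∫ p, f p.1 ^ 2 * F p.1 p.2 ^ 2 ∂(ρ.prod ρ)) *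
          ((∫ p, F p.1 p.2 ^ 2 ∂(ρ.prod ρ)) - ∫ p, F (T p.1) p.2 * F p.1 p.2 ∂(ρ.prod ρ)) ∧
      (∫ p, f p.1 * f p.2 * F p.1 p.2 ^ 2 ∂(ρ.prod ρ)) ^ 2 ≤
        2 * B ^ 2 * (∫ p, f p.1 ^ 2 * F p.1 p.2 ^ 2 ∂(ρ.prod ρ)) *
          ((∫ p, F p.1 p.2 ^ 2 ∂(ρ.prod ρ)) + ∫ p, F (T p.1) p.2 * F p.1 p.2 ∂(ρ.prod ρ)) := by
  set π : Measure (Y × Y) := ρ.prod ρ with hπ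
  -- the two sector components of `F`
  set Fp : Y × Y → ℝ := fun p => (F p.1 p.2 + F (T p.1) p.2) / 2 with hFp
  set Fm : Y × Y → ℝ := fun p => (F p.1 p.2 - F (T p.1) p.2) / 2 with hFm
  -- measurability and bounds
  have hC0 : ∀ x y, |F x y| ≤ C := fun x y => by simpa [Real.norm_eq_abs] using hFb x y
  have hB0 : ∀ x, |f x| ≤ B := fun x => by simpa [Real.norm_eq_abs] using hfb x
  have mF : Measurable fun p : Y × Y => F p.1 p.2 := hF
  have mG : Measurable fun p : Y × Y => F (T p.1) p.2 := hF.comp ((hTm.comp measurable_fst).prodMk measurable_snd)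
  have mf1 : Measurable fun p : Y × Y => f p.1 := hf.comp measurable_fst
  have mf2 : Measurable fun p : Y × Y => f p.2 := hf.comp measurable_snd
  have mFp : Measurable Fp := (mF.add mG).div_const 2
  have mFm : Measurable Fm := (mF.sub mG).div_const 2
  have bFp : ∀ p, ‖Fp p‖ ≤ C := fun p => by
    simp only [hFp, Real.norm_eq_abs]
    have h1 := hC0 p.1 p.2; have h2 := hC0 (T p.1) p.2
    rw [abs_le] at h1 h2 ⊢; constructor <;> linarith [h1.1, h1.2, h2.1, h2.2]
  have bFm : ∀ p, ‖Fm p‖ ≤ C := fun p => by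
    simp only [hFm, Real.norm_eq_abs]
    have h1 := hC0 p.1 p.2; have h2 := hC0 (T p.1) p.2
    rw [abs_le] at h1 h2 ⊢; constructor <;> linarith [h1.1, h1.2, h2.1, h2.2]
  have hB : ∀ p : Y × Y, 0 ≤ B := fun p => (abs_nonneg _).trans (hB0 p.1)
  -- parities under `x ↦ T x`
  have pFp : ∀ x y, Fp (T x, y) = Fp (x, y) := fun x y => by simp only [hFp, hTT]; ring
  have pFm : ∀ x y, Fm (T x, y) = -Fm (x, y) := fun x y => by simp only [hFm, hTT]; ring
  have hFsum : ∀ p, F p.1 p.2 = Fp p + Fm p := fun p => by simp only [hFp, hFm]; ring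
  -- the sector traces `∫ Fp² = (Z + Zᵀ)/2`, `∫ Fm² = (Z − Zᵀ)/2`
  have hG2 : ∫ p, F (T p.1) p.2 ^ 2 ∂π = ∫ p, F p.1 p.2 ^ 2 ∂π :=
    integral_comp_fst_involution hTm hT hTT (fun p => F p.1 p.2 ^ 2)
  have iF2 : Integrable (fun p : Y × Y => F p.1 p.2 ^ 2) π :=
    integrable_of_bdd π (mF.pow_const 2) (A := C ^ 2) fun p => by
      rw [norm_pow]; exact pow_le_pow_left₀ (norm_nonneg _) (hFb p.1 p.2) 2
  have iG2 : Integrable (fun p : Y × Y => F (T p.1) p.2 ^ 2) π :=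
    integrable_of_bdd π (mG.pow_const 2) (A := C ^ 2) fun p => by
      rw [norm_pow]; exact pow_le_pow_left₀ (norm_nonneg _) (hFb (T p.1) p.2) 2
  have iGF : Integrable (fun p : Y × Y => F (T p.1) p.2 * F p.1 p.2) π :=
    integrable_of_bdd π (mG.mul mF) (A := C * C) fun p => by
      rw [norm_mul]
      exact mul_le_mul (hFb (T p.1) p.2) (hFb p.1 p.2) (norm_nonneg _) ((norm_nonneg _).trans (hFb (T p.1) p.2))
  have hFp2 : ∫ p, Fp p ^ 2 ∂π = ((∫ p, F p.1 p.2 ^ 2 ∂π) + ∫ p, F (T p.1) p.2 * F p.1 p.2 ∂π) / 2 := by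
    have e : ∀ p, Fp p ^ 2 = (1 / 4) * F p.1 p.2 ^ 2 + (1 / 2) * (F (T p.1) p.2 * F p.1 p.2) +
        (1 / 4) * F (T p.1) p.2 ^ 2 := fun p => by simp only [hFp]; ring
    simp_rw [e]
    rw [integral_lin3 π iF2 iGF iG2, hG2]
    ring
  have hFm2 : ∫ p, Fm p ^ 2 ∂π = ((∫ p, F p.1 p.2 ^ 2 ∂π) - ∫ p, F (T p.1) p.2 * F p.1 p.2 ∂π) / 2 := by
    have e : ∀ p, Fm p ^ 2 = (1 / 4) * F p.1 p.2 ^ 2 + (-(1 / 2)) * (F (T p.1) p.2 * F p.1 p.2) +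
        (1 / 4) * F (T p.1) p.2 ^ 2 := fun p => by simp only [hFm]; ring
    simp_rw [e]
    rw [integral_lin3 π iF2 iGF iG2, hG2]
    ring
  -- integrability of the products used below (all bounded measurable)
  have hB' : 0 ≤ B ∨ IsEmpty (Y × Y) := by
    by_cases h : Nonempty (Y × Y)
    · exact Or.inl ((abs_nonneg _).trans (hB0 h.some.1))
    · exact Or.inr (not_nonempty_iff.mp h)
  have bf1 : ∀ p : Y × Y, ‖f p.1‖ ≤ B := fun p => hfb p.1
  have bf2 : ∀ p : Y × Y, ‖f p.2‖ ≤ B := fun p => hfb p.2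
  have bnd_mul : ∀ {u v : Y × Y → ℝ} {U V : ℝ}, (∀ p, ‖u p‖ ≤ U) → (∀ p, ‖v p‖ ≤ V) → ∀ p, ‖u p * v p‖ ≤ U * V :=
    fun hu hv p => by rw [norm_mul]; exact mul_le_mul (hu p) (hv p) (norm_nonneg _) ((norm_nonneg _).trans (hu p))
  -- (P3) `∫ f(x) f(y) Fp² = 0 = ∫ f(x) f(y) Fm²` (odd under `x ↦ Tx`)
  have hP3p : ∫ p, f p.1 * f p.2 * Fp p ^ 2 ∂π = 0 :=
    integral_eq_zero_of_odd_fst hTm hT hTT (g := fun p => f p.1 * f p.2 * Fp p ^ 2) fun x y => by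
      simp only [hfT, pFp]; ring
  have hP3m : ∫ p, f p.1 * f p.2 * Fm p ^ 2 ∂π = 0 :=
    integral_eq_zero_of_odd_fst hTm hT hTT (g := fun p => f p.1 * f p.2 * Fm p ^ 2) fun x y => by
      simp only [hfT, pFm]; ring
  -- (P4) `X = 2 ∫ (f(x) Fp)(f(y) Fm)`
  have iA : Integrable (fun p : Y × Y => f p.1 * f p.2 * Fp p ^ 2) π :=
    integrable_of_bdd π ((mf1.mul mf2).mul (mFp.pow_const 2)) (A := B * B * C ^ 2)
      (bnd_mul (bnd_mul bf1 bf2) fun p => by rw [norm_pow]; exact pow_le_pow_left₀ (norm_nonneg _) (bFp p) 2)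
  have iBm : Integrable (fun p : Y × Y => f p.1 * f p.2 * Fm p ^ 2) π :=
    integrable_of_bdd π ((mf1.mul mf2).mul (mFm.pow_const 2)) (A := B * B * C ^ 2)
      (bnd_mul (bnd_mul bf1 bf2) fun p => by rw [norm_pow]; exact pow_le_pow_left₀ (norm_nonneg _) (bFm p) 2)
  have iX : Integrable (fun p : Y × Y => (f p.1 * Fp p) * (f p.2 * Fm p)) π :=
    integrable_of_bdd π ((mf1.mul mFp).mul (mf2.mul mFm)) (A := (B * C) * (B * C))
      (bnd_mul (bnd_mul bf1 bFp) (bnd_mul bf2 bFm))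
  have hX : ∫ p, f p.1 * f p.2 * F p.1 p.2 ^ 2 ∂π = 2 * ∫ p, (f p.1 * Fp p) * (f p.2 * Fm p) ∂π := by
    have e : ∀ p : Y × Y, f p.1 * f p.2 * F p.1 p.2 ^ 2 =
        1 * (f p.1 * f p.2 * Fp p ^ 2) + 2 * ((f p.1 * Fp p) * (f p.2 * Fm p)) + 1 * (f p.1 * f p.2 * Fm p ^ 2) :=
      fun p => by rw [hFsum p]; ring
    simp_rw [e]
    rw [integral_lin3 π iA iX iBm, hP3p, hP3m]
    ring
  have hX' : ∫ p, f p.1 * f p.2 * F p.1 p.2 ^ 2 ∂π = 2 * ∫ p, (f p.1 * Fm p) * (f p.2 * Fp p) ∂π := by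
    rw [hX]
    congr 1
    exact integral_congr_ae (Eventually.of_forall fun p => by ring)
  -- (P6)/(P7) second moments: `∫ f(y)² F±² ≤ B² ∫ F±²`, `∫ f(x)² F±² ≤ W`
  have iFp2 : Integrable (fun p : Y × Y => Fp p ^ 2) π :=
    integrable_of_bdd π (mFp.pow_const 2) (A := C ^ 2) fun p => by
      rw [norm_pow]; exact pow_le_pow_left₀ (norm_nonneg _) (bFp p) 2
  have iFm2 : Integrable (fun p : Y × Y => Fm p ^ 2) π :=
    integrable_of_bdd π (mFm.pow_const 2) (A := C ^ 2) fun p => by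
      rw [norm_pow]; exact pow_le_pow_left₀ (norm_nonneg _) (bFm p) 2
  have hP6p : ∫ p, (f p.2 * Fp p) ^ 2 ∂π ≤ B ^ 2 * ∫ p, Fp p ^ 2 ∂π := by
    rw [← integral_const_mul]
    refine integral_mono_of_nonneg (Eventually.of_forall fun p => sq_nonneg _) (iFp2.const_mul _)
      (Eventually.of_forall fun p => ?_)
    have h1 : f p.2 ^ 2 ≤ B ^ 2 := by
      have := hB0 p.2; rw [abs_le] at this; nlinarith [this.1, this.2]
    show (f p.2 * Fp p) ^ 2 ≤ B ^ 2 * Fp p ^ 2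
    rw [mul_pow]; exact mul_le_mul_of_nonneg_right h1 (sq_nonneg _)
  have hP6m : ∫ p, (f p.2 * Fm p) ^ 2 ∂π ≤ B ^ 2 * ∫ p, Fm p ^ 2 ∂π := by
    rw [← integral_const_mul]
    refine integral_mono_of_nonneg (Eventually.of_forall fun p => sq_nonneg _) (iFm2.const_mul _)
      (Eventually.of_forall fun p => ?_)
    have h1 : f p.2 ^ 2 ≤ B ^ 2 := by
      have := hB0 p.2; rw [abs_le] at this; nlinarith [this.1, this.2]
    show (f p.2 * Fm p) ^ 2 ≤ B ^ 2 * Fm p ^ 2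
    rw [mul_pow]; exact mul_le_mul_of_nonneg_right h1 (sq_nonneg _)
  -- `W = ∫ (f(x) Fp)² + ∫ (f(x) Fm)²` (the cross term is odd under `x ↦ Tx`)
  have iWp : Integrable (fun p : Y × Y => (f p.1 * Fp p) ^ 2) π :=
    integrable_of_bdd π ((mf1.mul mFp).pow_const 2) (A := (B * C) ^ 2) fun p => by
      rw [norm_pow]; exact pow_le_pow_left₀ (norm_nonneg _) (bnd_mul bf1 bFp p) 2
  have iWm : Integrable (fun p : Y × Y => (f p.1 * Fm p) ^ 2) π :=
    integrable_of_bdd π ((mf1.mul mFm).pow_const 2) (A := (B * C) ^ 2) fun p => by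
      rw [norm_pow]; exact pow_le_pow_left₀ (norm_nonneg _) (bnd_mul bf1 bFm p) 2
  have iWx : Integrable (fun p : Y × Y => f p.1 ^ 2 * (Fp p * Fm p)) π :=
    integrable_of_bdd π ((mf1.pow_const 2).mul (mFp.mul mFm)) (A := B ^ 2 * (C * C))
      (bnd_mul (fun p => by rw [norm_pow]; exact pow_le_pow_left₀ (norm_nonneg _) (bf1 p) 2) (bnd_mul bFp bFm))
  have hWx : ∫ p, f p.1 ^ 2 * (Fp p * Fm p) ∂π = 0 :=
    integral_eq_zero_of_odd_fst hTm hT hTT (g := fun p => f p.1 ^ 2 * (Fp p * Fm p)) fun x y => by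
      simp only [hfT, pFp, pFm]; ring
  have hW : ∫ p, f p.1 ^ 2 * F p.1 p.2 ^ 2 ∂π = (∫ p, (f p.1 * Fp p) ^ 2 ∂π) + ∫ p, (f p.1 * Fm p) ^ 2 ∂π := by
    have e : ∀ p : Y × Y, f p.1 ^ 2 * F p.1 p.2 ^ 2 =
        1 * (f p.1 * Fp p) ^ 2 + 2 * (f p.1 ^ 2 * (Fp p * Fm p)) + 1 * (f p.1 * Fm p) ^ 2 := fun p => by
      rw [hFsum p]; ring
    simp_rw [e]
    rw [integral_lin3 π iWp iWx iWm, hWx]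
    ring
  have hWp_nonneg : 0 ≤ ∫ p, (f p.1 * Fp p) ^ 2 ∂π := integral_nonneg fun p => sq_nonneg _
  have hWm_nonneg : 0 ≤ ∫ p, (f p.1 * Fm p) ^ 2 ∂π := integral_nonneg fun p => sq_nonneg _
  have hW_nonneg : 0 ≤ ∫ p, f p.1 ^ 2 * F p.1 p.2 ^ 2 ∂π := by rw [hW]; exact add_nonneg hWp_nonneg hWm_nonneg
  -- (P5) Cauchy–Schwarz, twice
  have hCS1 := sq_integral_mul_le π (a := fun p => f p.1 * Fp p) (b := fun p => f p.2 * Fm p)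
    (mf1.mul mFp) (mf2.mul mFm) (bnd_mul bf1 bFp) (bnd_mul bf2 bFm)
  have hCS2 := sq_integral_mul_le π (a := fun p => f p.1 * Fm p) (b := fun p => f p.2 * Fp p)
    (mf1.mul mFm) (mf2.mul mFp) (bnd_mul bf1 bFm) (bnd_mul bf2 bFp)
  beta_reduce at hCS1 hCS2
  have hZm_nonneg : 0 ≤ ∫ p, Fm p ^ 2 ∂π := integral_nonneg fun p => sq_nonneg _
  have hZp_nonneg : 0 ≤ ∫ p, Fp p ^ 2 ∂π := integral_nonneg fun p => sq_nonneg _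
  constructor
  · -- odd sector: `X² = 4 (∫ (f Fp)(f Fm))² ≤ 4 · W · B² (Z − Zᵀ)/2`
    rw [hX]
    have h1 : (∫ p, (f p.1 * Fp p) * (f p.2 * Fm p) ∂π) ^ 2 ≤
        (∫ p, f p.1 ^ 2 * F p.1 p.2 ^ 2 ∂π) * (B ^ 2 * ∫ p, Fm p ^ 2 ∂π) :=
      hCS1.trans (mul_le_mul (by rw [hW]; linarith) hP6m (integral_nonneg fun p => sq_nonneg _) hW_nonneg)
    rw [hFm2] at h1
    nlinarith [h1]
  · -- even sector: `X² = 4 (∫ (f Fm)(f Fp))² ≤ 4 · W · B² (Z + Zᵀ)/2`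
    rw [hX']
    have h1 : (∫ p, (f p.1 * Fm p) * (f p.2 * Fp p) ∂π) ^ 2 ≤
        (∫ p, f p.1 ^ 2 * F p.1 p.2 ^ 2 ∂π) * (B ^ 2 * ∫ p, Fp p ^ 2 ∂π) :=
      hCS2.trans (mul_le_mul (by rw [hW]; linarith) hP6p (integral_nonneg fun p => sq_nonneg _) hW_nonneg)
    rw [hFp2] at h1
    nlinarith [h1]

end Sector

end Summit.QuantumFields.YangMills.Cruxes.IR.HeavyTwistWall

end
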